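import Literature.NumberTheory.Transcendental.LWMeasureAnalytic
import Literature.NumberTheory.Transcendental.HermiteInterpolationBound
import Literature.NumberTheory.Transcendental.DiazPoints
import HarnessLib

/-!
# The auxiliary polynomials of the Lindemann–Weierstrass measure (Ably 1994, §II, 2e pas) — smallness

`Literature/NumberTheory/Transcendental/LWMeasureSmallness.lean` — proofs (and four real-valued
abbreviations with bodies), no named facts. Fourth file of the proof of Ably's "Proposition
principale" behind `Ably1994_lindemannWeierstrass_measure`: the estimates of the 2e pas
(pp. 37–39) in closed form, for the final choice of parameters to consume.

* `hermite_pts` — Hermite's extrapolation with multiplicities on the points `h·v`, `h ∈ [0,M)ᵐ`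
  ("formule d'extrapolation ([R], lemme 4.5)", p. 38): `Hermite.norm_iteratedDeriv_le_of_small_jets`
  fed with the point count / size / separation / product bound of `DiazPoints.lean`
  (`ptsRad`, `ptsProd` name the radius `max(1, M∑|v_k|)` and the product bound `(δω^M)^{M^{m−1}}`).
* `Setup.norm_aeval_Pj_le`, `Setup.norm_aeval_Pj_sub_le`, `Setup.norm_aeval_Mt_le`,
  `Setup.norm_aeval_Mt_sub_le` — sizes and Lipschitz bounds of `P_{β,γ,j}` and `M̃_{β,γ,h,s}` at
  the points `(α, z)`, `max|zⱼ − e^{yⱼ}| ≤ 1` (Lemme 2, pp. 36–37), from `IntegerTaylor.lean`.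
* `Setup.norm_iteratedDeriv_F_hy_le` — (4)–(5) p. 38: for `s < T'`, `h ∈ [0,M)ⁿ`, with `j`
  minimal at `x̃ = (α, z̃)`, `max|z̃ⱼ − e^{yⱼ}| ≤ ε`, and `f = ∑ P_{β,γ,j}(x̃) z^β e^{γz}`:
  `|f^{(s)}(h·y)| ≤ LD · 2^{n(b−1)}bⁿH A^{n(b−1)} · (L+D)^s K₁(M)^L degM A^{degM} · ε`
  (since `c^L f^{(s)}(h·y) − Q_{s,h,j}(x̃) = ∑ a (M̃(α,e^y) − M̃(x̃))` and `Q_{s,h,j}(x̃) = 0`).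
* `Setup.norm_F_le` — `|f|_{R_c} ≤ LD · 2^{n(b−1)}bⁿH A^{n(b−1)} · R_c^L e^{DR_c}` (p. 38).
* `Setup.norm_aeval_Qj_le` — (6) p. 39:
  `|Q_{s,h,j}(α, e^y)| ≤ LD(Lipschitz term)ε + |c|^L |f^{(s)}(h·y)|`.

## References

* [Ably1994] M. Ably, *Une version quantitative du théorème de Lindemann–Weierstrass*, Acta Arith.
  67 (1994) 29–45, §II Lemme 2 and 2e pas, pp. 36–39.
* [Diaz1989] G. Diaz, *Grands degrés de transcendance …*, J. Number Theory 31 (1989), §II-3-2 (c)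
  (the interpolation points and their separation).
-/

noncomputable section

open scoped Polynomial Nat
open MvPolynomial Finset Finsupp Complex Metric

namespace Literature.NumberTheory.Transcendental

namespace LWMeasure

open Chudnovsky (l1 wnorm_nonneg norm_aeval_le_l1)
open DiazThm1 (muv pts Separated card_pts norm_le_of_mem_pts le_norm_muv_sub_muv
  prod_pts_erase_ge injOn_muv le_norm_last_of_separated)

/-! ### Hermite's extrapolation on the point set `{h·v : h ∈ [0,M)ᵐ}` -/

/-- The radius `ρ = max(1, M ∑|v_k|)` containing the points `h·v`, `h ∈ [0,M)ᵐ`. [folklore] -/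
def ptsRad {m : ℕ} (v : Fin m → ℂ) (M : ℕ) : ℝ := max 1 ((M : ℝ) * ∑ k, ‖v k‖)

/-- `|v_m|`, the modulus of the last coordinate (`0` for `m = 0`). [folklore] -/
def lastNorm {m : ℕ} (v : Fin m → ℂ) : ℝ := if h : 0 < m then ‖v ⟨m - 1, by omega⟩‖ else 0

/-- `lastNorm` of a family indexed by `Fin (m' + 1)`. [folklore] -/
theorem lastNorm_succ {m' : ℕ} (v : Fin (m' + 1) → ℂ) : lastNorm v = ‖v (Fin.last m')‖ := by
  unfold lastNorm
  rw [dif_pos (Nat.succ_pos m')]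
  rfl

/-- The product lower bound `Λ₀ = (δ ω^M)^{M^{m-1}}`, `ω = min(1, |v_m|/2)`, of `DiazPoints.lean`.
[folklore] -/
def ptsProd {m : ℕ} (v : Fin m → ℂ) (M : ℕ) (δ : ℝ) : ℝ :=
  (δ * (min 1 (lastNorm v / 2)) ^ M) ^ (M ^ (m - 1))

/-- `ρ ≥ 1`. [folklore] -/
theorem one_le_ptsRad {m : ℕ} (v : Fin m → ℂ) (M : ℕ) : 1 ≤ ptsRad v M := le_max_left _ _

/-- `Λ₀ > 0` for separated points (`M ≥ 2`, `m ≥ 1`). [folklore] -/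
theorem ptsProd_pos {m : ℕ} (hm : 1 ≤ m) (v : Fin m → ℂ) {M : ℕ} (hM : 2 ≤ M) {δ : ℝ}
    (hsep : Separated v M δ) (hδ : 0 < δ) : 0 < ptsProd v M δ := by
  obtain ⟨m', rfl⟩ : ∃ m', m = m' + 1 := ⟨m - 1, by omega⟩
  unfold ptsProd
  rw [lastNorm_succ]
  have hω0 : 0 < min 1 (‖v (Fin.last m')‖ / 2) := by
    rw [lt_min_iff]
    refine ⟨one_pos, ?_⟩
    have := le_norm_last_of_separated hsep hM
    linarith
  positivity

/-- `Λ₀ ≤ 1` (`0 < δ ≤ 1`). [folklore] -/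
theorem ptsProd_le_one {m : ℕ} (v : Fin m → ℂ) (M : ℕ) {δ : ℝ} (hδ : 0 ≤ δ) (hδ1 : δ ≤ 1) :
    ptsProd v M δ ≤ 1 := by
  unfold ptsProd
  have h1 : min 1 (lastNorm v / 2) ≤ 1 := min_le_left _ _
  by_cases h0 : 0 ≤ min 1 (lastNorm v / 2)
  · exact pow_le_one₀ (by positivity) (mul_le_one₀ hδ1 (pow_nonneg h0 _) (pow_le_one₀ h0 h1))
  · push Not at h0
    -- `lastNorm ≥ 0`, so this case is empty
    exfalso
    have : 0 ≤ lastNorm v := by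
      unfold lastNorm; split_ifs <;> [exact norm_nonneg _; exact le_rfl]
    have : (0 : ℝ) ≤ min 1 (lastNorm v / 2) := le_min zero_le_one (by linarith)
    linarith

/-- **Hermite's extrapolation on the points `h·v`, `h ∈ [0,M)ᵐ`** (`m ≥ 1`, `M ≥ 2`): if the
points are `δ`-separated (`0 < δ ≤ 1`), an entire `f` with `|f^{(σ)}(e)| ≤ ε` for all points `e`
and `σ < S`, and `|f| ≤ B` on `|z| = R_c`, `R_c ≥ ρ + 2` (`ρ = ptsRad v M`), satisfies, at every
point `e` and for every `s`,
`|f^{(s)}(e)| ≤ s! (𝓗(ρ+1) + (B + 𝓗(R_c)) ((2ρ+1)/(R_c − ρ))^{S Mᵐ})`,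
`𝓗(t) = Mᵐ S ε (2(t+ρ))^{S Mᵐ} (2/δ)^S / Λ₀^S`, `Λ₀ = ptsProd v M δ`
(`Hermite.norm_iteratedDeriv_le_of_small_jets` with the point count, size, separation and product
bound of `DiazPoints.lean`; Ably's "formule d'extrapolation ([R], lemme 4.5)", p. 38).
[cite: Ably1994, §II 2e pas p. 38] -/
theorem hermite_pts {m : ℕ} (hm : 1 ≤ m) (v : Fin m → ℂ) {M : ℕ} (hM : 2 ≤ M) {δ : ℝ}
    (hsep : Separated v M δ) (hδ : 0 < δ) (hδ1 : δ ≤ 1) {f : ℂ → ℂ} (hf : Differentiable ℂ f)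
    (S : ℕ) {ε B Rc : ℝ} (hε : 0 ≤ ε)
    (hsmall : ∀ e ∈ pts v M, ∀ σ < S, ‖iteratedDeriv σ f e‖ ≤ ε)
    (hRc : ptsRad v M + 2 ≤ Rc)
    (hB : ∀ z ∈ sphere (0 : ℂ) Rc, ‖f z‖ ≤ B) {e : ℂ} (he : e ∈ pts v M) (s : ℕ) :
    ‖iteratedDeriv s f e‖ ≤ s ! *
      (((M ^ m : ℕ) : ℝ) * S * ε * (2 * (ptsRad v M + 1 + ptsRad v M)) ^ (S * M ^ m) *
          (2 / δ) ^ S / ptsProd v M δ ^ S +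
        (B + ((M ^ m : ℕ) : ℝ) * S * ε * (2 * (Rc + ptsRad v M)) ^ (S * M ^ m) *
          (2 / δ) ^ S / ptsProd v M δ ^ S) *
          ((ptsRad v M + 1 + ptsRad v M) / (Rc - ptsRad v M)) ^ (S * M ^ m)) := by
  have hΛ₀0 := ptsProd_pos hm v hM hsep hδ
  obtain ⟨m', rfl⟩ : ∃ m', m = m' + 1 := ⟨m - 1, by omega⟩
  have hρ1 : 1 ≤ ptsRad v M := one_le_ptsRad v M
  have hcard : (pts v M).card = M ^ (m' + 1) := card_pts hsep hδ
  have hE : ∀ e' ∈ pts v M, ‖e'‖ ≤ ptsRad v M := fun e' he' =>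
    (norm_le_of_mem_pts v he').trans (le_max_right _ _)
  have hsep' : ∀ e₁ ∈ pts v M, ∀ e₂ ∈ pts v M, e₁ ≠ e₂ → δ ≤ ‖e₁ - e₂‖ := by
    intro e₁ he₁ e₂ he₂ hne
    obtain ⟨μ₁, hμ₁, rfl⟩ := mem_image.mp he₁
    obtain ⟨μ₂, hμ₂, rfl⟩ := mem_image.mp he₂
    exact le_norm_muv_sub_muv hsep hμ₁ hμ₂ fun h => hne (by rw [h])
  have hprod : ∀ e' ∈ pts v M, ptsProd v M δ ≤ ∏ e'' ∈ (pts v M).erase e', ‖e' - e''‖ := by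
    intro e' he'
    have := prod_pts_erase_ge v hsep hδ hδ1 he'
    unfold ptsProd
    rwa [lastNorm_succ, Nat.add_sub_cancel]
  have key := Hermite.norm_iteratedDeriv_le_of_small_jets hf (pts v M) S (r := ptsRad v M)
    (R := Rc) (ρ := ptsRad v M) hρ1 (zero_le_one.trans hρ1) (by linarith) (by linarith) hδ hδ1
    hΛ₀0 hε hE hsep' hprod hsmall hB (hE e he) s
  rw [hcard] at key
  exact key

/-! ### Sizes at the points `(α, z)` near `θ = (α, e^{y₁}, …, e^{yₙ})` -/

namespace Setup

variable (S : Setup) {L D b : ℕ}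

/-- A common bound `A = 2 + |α| + ∑|e^{yⱼ}|` for the coordinates of the points `(α, z)`,
`max|zⱼ - e^{yⱼ}| ≤ 1`. [folklore] -/
def A : ℝ := 2 + ‖S.α‖ + ∑ j, ‖cexp (S.y j)‖

/-- `A ≥ 1`. [folklore] -/
theorem one_le_A : 1 ≤ S.A := by
  unfold A
  have h1 : 0 ≤ ‖S.α‖ := norm_nonneg _
  have h2 : 0 ≤ ∑ j, ‖cexp (S.y j)‖ := sum_nonneg fun j _ => norm_nonneg _
  linarith

/-- Coordinates of `(α, z)` are `≤ A` when `max|zⱼ - e^{yⱼ}| ≤ 1`. [folklore] -/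
theorem norm_cons_le_A {z : Fin S.n → ℂ} (hz : ∀ j, ‖z j - S.θ j‖ ≤ 1) (i : Fin (S.n + 1)) :
    ‖(Fin.cons S.α z : Fin (S.n + 1) → ℂ) i‖ ≤ S.A := by
  unfold A
  have h1 : 0 ≤ ‖S.α‖ := norm_nonneg _
  have h2 : 0 ≤ ∑ j, ‖cexp (S.y j)‖ := sum_nonneg fun j _ => norm_nonneg _
  refine Fin.cases ?_ (fun j => ?_) i
  · simp only [Fin.cons_zero]; linarith
  · simp only [Fin.cons_succ]
    have h3 : ‖z j‖ ≤ ‖S.θ j‖ + 1 := by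
      have := norm_le_norm_add_norm_sub' (z j) (S.θ j)
      linarith [hz j]
    have h4 : ‖S.θ j‖ ≤ ∑ k, ‖cexp (S.y k)‖ :=
      single_le_sum (f := fun k => ‖cexp (S.y k)‖) (fun k _ => norm_nonneg _) (mem_univ j)
    simp only [θ_apply] at h3 h4 ⊢
    linarith

/-- The true point is within distance `1` of itself. [folklore] -/
theorem norm_θ_sub_θ_le (j : Fin S.n) : ‖S.θ j - S.θ j‖ ≤ 1 := by simp

/-- **`|P_{β,γ,j}(α, z)| ≤ 2^{n(b-1)} bⁿ H A^{n(b-1)}`** (`|p| ≤ H`, `max|zⱼ - e^{yⱼ}| ≤ 1`).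
[cite: Ably1994, §II Lemme 2 p. 37 ("`|D^jP_{β,γ}(θ̃)| ≤ exp(φ₂)`")] -/
theorem norm_aeval_Pj_le (p : Unk S.n L D b → ℤ) {H : ℝ} (hH0 : 0 ≤ H)
    (hH : ∀ w, |(p w : ℝ)| ≤ H) {z : Fin S.n → ℂ} (hz : ∀ j, ‖z j - S.θ j‖ ≤ 1)
    (βγ : Fin L × Fin D) (j : Fin (S.n + 1) →₀ ℕ) :
    ‖aeval (Fin.cons S.α z : Fin (S.n + 1) → ℂ) (S.Pj p βγ j)‖ ≤
      2 ^ (S.n * (b - 1)) * ((b : ℝ) ^ S.n * H) * S.A ^ (S.n * (b - 1)) := by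
  have hA := S.one_le_A
  refine (norm_aeval_le_l1 _ _ hA (S.norm_cons_le_A hz)).trans ?_
  exact mul_le_mul (S.l1_Pj_le p hH βγ j) (pow_le_pow_right₀ hA (S.totalDegree_Pj_le p βγ j))
    (by positivity) (by positivity)

/-- **Lipschitz bound for `P_{β,γ,j}`**: `|P_{β,γ,j}(α, e^y) - P_{β,γ,j}(α, z̃)| ≤
2^{n(b-1)} bⁿ H · n(b-1) A^{n(b-1)} ε` for `max|z̃ⱼ - e^{yⱼ}| ≤ ε ≤ 1`.
[cite: Ably1994, §II Lemme 2 p. 36 (the first display of its proof)] -/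
theorem norm_aeval_Pj_sub_le (p : Unk S.n L D b → ℤ) {H : ℝ} (hH0 : 0 ≤ H)
    (hH : ∀ w, |(p w : ℝ)| ≤ H) {z : Fin S.n → ℂ} {ε : ℝ} (hε0 : 0 ≤ ε) (hε1 : ε ≤ 1)
    (hz : ∀ j, ‖z j - S.θ j‖ ≤ ε) (βγ : Fin L × Fin D) (j : Fin (S.n + 1) →₀ ℕ) :
    ‖aeval (Fin.cons S.α S.θ : Fin (S.n + 1) → ℂ) (S.Pj p βγ j) -
        aeval (Fin.cons S.α z : Fin (S.n + 1) → ℂ) (S.Pj p βγ j)‖ ≤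
      2 ^ (S.n * (b - 1)) * ((b : ℝ) ^ S.n * H) * ((S.n * (b - 1) : ℕ) : ℝ) *
        S.A ^ (S.n * (b - 1)) * ε := by
  have hA := S.one_le_A
  have hz1 : ∀ j, ‖z j - S.θ j‖ ≤ 1 := fun j => (hz j).trans hε1
  have hdiff : ∀ i, ‖(Fin.cons S.α S.θ : Fin (S.n + 1) → ℂ) i -
      (Fin.cons S.α z : Fin (S.n + 1) → ℂ) i‖ ≤ ε := by
    intro i
    refine Fin.cases ?_ (fun j => ?_) i
    · simp [hε0]
    · simp only [Fin.cons_succ]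
      rw [norm_sub_rev]
      exact hz j
  refine (norm_aeval_sub_aeval_le _ _ _ hA hε0 (S.norm_cons_le_A (fun j => S.norm_θ_sub_θ_le j))
    (S.norm_cons_le_A hz1) hdiff).trans ?_
  have hdeg := S.totalDegree_Pj_le p βγ j
  have hdegR : ((S.Pj p βγ j).totalDegree : ℝ) ≤ ((S.n * (b - 1) : ℕ) : ℝ) := by exact_mod_cast hdeg
  have hl1 := S.l1_Pj_le p hH βγ j
  have hpow : S.A ^ (S.Pj p βγ j).totalDegree ≤ S.A ^ (S.n * (b - 1)) := pow_le_pow_right₀ hA hdeg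
  have h0 : 0 ≤ l1 (S.Pj p βγ j) := wnorm_nonneg _ _
  calc l1 (S.Pj p βγ j) * (S.Pj p βγ j).totalDegree * S.A ^ (S.Pj p βγ j).totalDegree * ε
      ≤ (2 ^ (S.n * (b - 1)) * ((b : ℝ) ^ S.n * H)) * ((S.n * (b - 1) : ℕ) : ℝ) *
          S.A ^ (S.n * (b - 1)) * ε := by
        gcongr
    _ = _ := by ring

/-- The common degree bound `d - 1 + (D-1) n (M-1)` of the `M̃_{β,γ,h,s}`, `γ < D`, `hⱼ < M`.
[folklore] -/
def degM (D M : ℕ) : ℕ := S.d - 1 + (D - 1) * (S.n * (M - 1))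

/-- `deg M̃_{β,γ,h,s} ≤ degM` for `γ < D`, `hⱼ < M`. [folklore] -/
theorem totalDegree_Mt_le' (L β : ℕ) {γ D M : ℕ} (hγ : γ < D) {h : Fin S.n → ℕ}
    (hh : ∀ j, h j < M) (s : ℕ) : (S.Mt L β γ h s).totalDegree ≤ S.degM D M := by
  refine (S.totalDegree_Mt_le L β γ h s).trans (Nat.add_le_add_left ?_ _)
  calc γ * ∑ i, h i ≤ (D - 1) * ∑ _i : Fin S.n, (M - 1) := by
        refine Nat.mul_le_mul (by omega) (Finset.sum_le_sum fun i _ => ?_)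
        have := hh i; omega
    _ = (D - 1) * (S.n * (M - 1)) := by simp

/-- **`|M̃_{β,γ,h,s}(α, z)| ≤ (L + D)^s K₁(M)^L A^{degM}`** (`β < L`, `γ < D`, `hⱼ < M`,
`max|zⱼ - e^{yⱼ}| ≤ 1`). [cite: Ably1994, §II Lemme 2 p. 37 ("`|M_{β,γ,s,h}(θ̃)| ≤ exp(φ₂)`")] -/
theorem norm_aeval_Mt_le {β γ M : ℕ} (hβ : β < L) (hγ : γ < D) {h : Fin S.n → ℕ}
    (hh : ∀ j, h j < M) (s : ℕ) {z : Fin S.n → ℂ} (hz : ∀ j, ‖z j - S.θ j‖ ≤ 1) :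
    ‖aeval (Fin.cons S.α z : Fin (S.n + 1) → ℂ) (S.Mt L β γ h s)‖ ≤
      ((L : ℝ) + D) ^ s * S.K₁ M ^ L * S.A ^ S.degM D M := by
  have hA := S.one_le_A
  have hK := S.one_le_K₁ M
  refine (norm_aeval_le_l1 _ _ hA (S.norm_cons_le_A hz)).trans ?_
  refine mul_le_mul ((S.l1_Mt_le hβ γ (fun j => (hh j).le) s).trans ?_)
    (pow_le_pow_right₀ hA (S.totalDegree_Mt_le' L β hγ hh s)) (by positivity) (by positivity)
  refine mul_le_mul_of_nonneg_right (pow_le_pow_left₀ (by positivity) ?_ _)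
    (pow_nonneg (zero_le_one.trans hK) _)
  have h1 : (β : ℝ) ≤ L := by exact_mod_cast hβ.le
  have h2 : (γ : ℝ) ≤ D := by exact_mod_cast hγ.le
  linarith

/-- **Lipschitz bound for `M̃_{β,γ,h,s}`**:
`|M̃(α, e^y) - M̃(α, z̃)| ≤ (L + D)^s K₁(M)^L · degM · A^{degM} · ε` for
`max|z̃ⱼ - e^{yⱼ}| ≤ ε ≤ 1`. [cite: Ably1994, §II Lemme 2 p. 37 ("`|M(θ̃) - M(θ)| ≤ exp(-r + φ₂)`")] -/
theorem norm_aeval_Mt_sub_le {β γ M : ℕ} (hβ : β < L) (hγ : γ < D) {h : Fin S.n → ℕ}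
    (hh : ∀ j, h j < M) (s : ℕ) {z : Fin S.n → ℂ} {ε : ℝ} (hε0 : 0 ≤ ε) (hε1 : ε ≤ 1)
    (hz : ∀ j, ‖z j - S.θ j‖ ≤ ε) :
    ‖aeval (Fin.cons S.α S.θ : Fin (S.n + 1) → ℂ) (S.Mt L β γ h s) -
        aeval (Fin.cons S.α z : Fin (S.n + 1) → ℂ) (S.Mt L β γ h s)‖ ≤
      ((L : ℝ) + D) ^ s * S.K₁ M ^ L * (S.degM D M : ℝ) * S.A ^ S.degM D M * ε := by
  have hA := S.one_le_A
  have hK := S.one_le_K₁ M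
  have hz1 : ∀ j, ‖z j - S.θ j‖ ≤ 1 := fun j => (hz j).trans hε1
  have hdiff : ∀ i, ‖(Fin.cons S.α S.θ : Fin (S.n + 1) → ℂ) i -
      (Fin.cons S.α z : Fin (S.n + 1) → ℂ) i‖ ≤ ε := by
    intro i
    refine Fin.cases ?_ (fun j => ?_) i
    · simp [hε0]
    · simp only [Fin.cons_succ]
      rw [norm_sub_rev]
      exact hz j
  refine (norm_aeval_sub_aeval_le _ _ _ hA hε0 (S.norm_cons_le_A (fun j => S.norm_θ_sub_θ_le j))
    (S.norm_cons_le_A hz1) hdiff).trans ?_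
  have hdeg := S.totalDegree_Mt_le' L β hγ hh s
  have hdegR : ((S.Mt L β γ h s).totalDegree : ℝ) ≤ (S.degM D M : ℝ) := by exact_mod_cast hdeg
  have hl1 : l1 (S.Mt L β γ h s) ≤ ((L : ℝ) + D) ^ s * S.K₁ M ^ L := by
    refine (S.l1_Mt_le hβ γ (fun j => (hh j).le) s).trans ?_
    refine mul_le_mul_of_nonneg_right (pow_le_pow_left₀ (by positivity) ?_ _)
      (pow_nonneg (zero_le_one.trans hK) _)
    have h1 : (β : ℝ) ≤ L := by exact_mod_cast hβ.le
    have h2 : (γ : ℝ) ≤ D := by exact_mod_cast hγ.le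
    linarith
  have hpow : S.A ^ (S.Mt L β γ h s).totalDegree ≤ S.A ^ S.degM D M := pow_le_pow_right₀ hA hdeg
  have h0 : 0 ≤ l1 (S.Mt L β γ h s) := wnorm_nonneg _ _
  calc l1 (S.Mt L β γ h s) * (S.Mt L β γ h s).totalDegree * S.A ^ (S.Mt L β γ h s).totalDegree * ε
      ≤ (((L : ℝ) + D) ^ s * S.K₁ M ^ L) * (S.degM D M : ℝ) * S.A ^ S.degM D M * ε := by
        gcongr
    _ = _ := by ring

/-! ### The small jets of `f` at the interpolation points (Lemme 2 and (5)) -/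

/-- **(5), p. 38: the `T'`-jets of `f` at the points `h·y` are small.** Let `Q_{s,h} = 0`
(`s < T'`, `h ∈ [0,M)ⁿ`, Lemme 1), `j` minimal at `x̃ = (α, z̃)` with `max|z̃ⱼ - e^{yⱼ}| ≤ ε ≤ 1`,
and `f = ∑ a_{β,γ} z^β e^{γz}` with `a_{β,γ} = P_{β,γ,j}(x̃)`. Then
`|f^{(s)}(h·y)| ≤ LD · 2^{n(b-1)} bⁿ H A^{n(b-1)} · (L+D)^s K₁(M)^L degM A^{degM} · ε`
(because `c^L f^{(s)}(h·y) = ∑ a (M̃(α,e^y) - M̃(α,z̃)) + Q_{s,h,j}(x̃)` and `Q_{s,h,j}(x̃) = 0`).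
[cite: Ably1994, §II Lemme 2 p. 36 and (4), (5) p. 38] -/
theorem norm_iteratedDeriv_F_hy_le (p : Unk S.n L D b → ℤ) {H : ℝ} (hH0 : 0 ≤ H)
    (hH : ∀ w, |(p w : ℝ)| ≤ H) {M : ℕ} {h : Fin S.n → ℕ} (hh : ∀ j, h j < M) {s : ℕ}
    (hQ : S.Q p h s = 0) {z : Fin S.n → ℂ} {ε : ℝ} (hε0 : 0 ≤ ε) (hε1 : ε ≤ 1)
    (hz : ∀ j, ‖z j - S.θ j‖ ≤ ε) {j : Fin (S.n + 1) →₀ ℕ}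
    (hj : S.IsMinIdx p (Fin.cons S.α z) j) :
    ‖iteratedDeriv s (F fun β γ => aeval (Fin.cons S.α z : Fin (S.n + 1) → ℂ) (S.Pj p (β, γ) j))
        (S.hy h)‖ ≤
      (L : ℝ) * D * ((2 ^ (S.n * (b - 1)) * ((b : ℝ) ^ S.n * H) * S.A ^ (S.n * (b - 1))) *
        (((L : ℝ) + D) ^ s * S.K₁ M ^ L * (S.degM D M : ℝ) * S.A ^ S.degM D M * ε)) := by
  classical
  set x : Fin (S.n + 1) → ℂ := Fin.cons S.α z with hx
  set a : Fin L → Fin D → ℂ := fun β γ => aeval x (S.Pj p (β, γ) j) with ha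
  have hz1 : ∀ j, ‖z j - S.θ j‖ ≤ 1 := fun j => (hz j).trans hε1
  -- `c^L f^{(s)}(h·y) = ∑ a M̃(α, e^y)` and `0 = Q_{s,h,j}(x̃) = ∑ a M̃(x̃)`
  have h1 := S.sum_mul_aeval_Mt_exp a h s
  have h2 : ∑ βγ : Fin L × Fin D, a βγ.1 βγ.2 * aeval x (S.Mt L βγ.1 βγ.2 h s) = 0 := by
    rw [← S.aeval_Qj_eq_zero_of_isMinIdx hQ hj, aeval_Qj]
  have h3 : (S.c : ℂ) ^ L * iteratedDeriv s (F a) (S.hy h) =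
      ∑ βγ : Fin L × Fin D, a βγ.1 βγ.2 *
        (aeval (Fin.cons S.α S.θ : Fin (S.n + 1) → ℂ) (S.Mt L βγ.1 βγ.2 h s) -
          aeval x (S.Mt L βγ.1 βγ.2 h s)) := by
    rw [← h1, ← sub_zero (∑ βγ : Fin L × Fin D, _), ← h2, ← Finset.sum_sub_distrib]
    exact Finset.sum_congr rfl fun βγ _ => by ring
  -- norms
  have hA0 : 0 ≤ S.A := zero_le_one.trans S.one_le_A
  have hK0 : 0 ≤ S.K₁ M := zero_le_one.trans (S.one_le_K₁ M)
  have hc1 : (1 : ℝ) ≤ ‖(S.c : ℂ) ^ L‖ := by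
    rw [norm_pow, Complex.norm_intCast]
    exact one_le_pow₀ S.one_le_abs_c
  have hbound : ‖(S.c : ℂ) ^ L * iteratedDeriv s (F a) (S.hy h)‖ ≤
      (L : ℝ) * D * ((2 ^ (S.n * (b - 1)) * ((b : ℝ) ^ S.n * H) * S.A ^ (S.n * (b - 1))) *
        (((L : ℝ) + D) ^ s * S.K₁ M ^ L * (S.degM D M : ℝ) * S.A ^ S.degM D M * ε)) := by
    rw [h3]
    refine (norm_sum_le _ _).trans ?_
    have hterm : ∀ βγ : Fin L × Fin D, ‖a βγ.1 βγ.2 *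
        (aeval (Fin.cons S.α S.θ : Fin (S.n + 1) → ℂ) (S.Mt L βγ.1 βγ.2 h s) -
          aeval x (S.Mt L βγ.1 βγ.2 h s))‖ ≤
        (2 ^ (S.n * (b - 1)) * ((b : ℝ) ^ S.n * H) * S.A ^ (S.n * (b - 1))) *
          (((L : ℝ) + D) ^ s * S.K₁ M ^ L * (S.degM D M : ℝ) * S.A ^ S.degM D M * ε) := by
      intro βγ
      rw [norm_mul]
      exact mul_le_mul (S.norm_aeval_Pj_le p hH0 hH hz1 (βγ.1, βγ.2) j)
        (S.norm_aeval_Mt_sub_le βγ.1.isLt βγ.2.isLt hh s hε0 hε1 hz) (norm_nonneg _)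
        (by positivity)
    calc ∑ βγ : Fin L × Fin D, ‖a βγ.1 βγ.2 *
          (aeval (Fin.cons S.α S.θ : Fin (S.n + 1) → ℂ) (S.Mt L βγ.1 βγ.2 h s) -
            aeval x (S.Mt L βγ.1 βγ.2 h s))‖
        ≤ ∑ _βγ : Fin L × Fin D, (2 ^ (S.n * (b - 1)) * ((b : ℝ) ^ S.n * H) * S.A ^ (S.n * (b - 1))) *
          (((L : ℝ) + D) ^ s * S.K₁ M ^ L * (S.degM D M : ℝ) * S.A ^ S.degM D M * ε) :=
          Finset.sum_le_sum fun βγ _ => hterm βγ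
      _ = _ := by
          simp [Finset.sum_const, Finset.card_univ, Fintype.card_prod, Fintype.card_fin, mul_assoc]
  rw [norm_mul] at hbound
  have h0 : 0 ≤ ‖iteratedDeriv s (F a) (S.hy h)‖ := norm_nonneg _
  calc ‖iteratedDeriv s (F a) (S.hy h)‖ ≤ ‖(S.c : ℂ) ^ L‖ * ‖iteratedDeriv s (F a) (S.hy h)‖ :=
        le_mul_of_one_le_left h0 hc1
    _ ≤ _ := hbound

/-- **`|f|` on a circle**: `|f(z)| ≤ L D · 2^{n(b-1)} bⁿ H A^{n(b-1)} · R_c^L e^{D R_c}` for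
`|z| ≤ R_c`, `R_c ≥ 1`. [cite: Ably1994, §II 2e pas p. 38 ("`|f|_{R₁} ≤ LD max|D^jP(θ̃)| R₁^L e^{R₁D}`")] -/
theorem norm_F_le (p : Unk S.n L D b → ℤ) {H : ℝ} (hH0 : 0 ≤ H) (hH : ∀ w, |(p w : ℝ)| ≤ H)
    {z : Fin S.n → ℂ} (hz : ∀ j, ‖z j - S.θ j‖ ≤ 1) (j : Fin (S.n + 1) →₀ ℕ) {Rc : ℝ}
    (hRc : 1 ≤ Rc) {w : ℂ} (hw : ‖w‖ ≤ Rc) :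
    ‖F (fun β γ => aeval (Fin.cons S.α z : Fin (S.n + 1) → ℂ) (S.Pj p (β, γ) j)) w‖ ≤
      (L : ℝ) * D * (2 ^ (S.n * (b - 1)) * ((b : ℝ) ^ S.n * H) * S.A ^ (S.n * (b - 1))) *
        Rc ^ L * Real.exp (D * Rc) :=
  BrownawellWaldschmidt.norm_expPolynomial_le _ _
    (fun β γ => S.norm_aeval_Pj_le p hH0 hH hz (β, γ) j) (fun γ => norm_freq_le γ) hRc hw

/-- **The value `Q_{s,h,j}(α, e^y)` against `f^{(s)}(h·y)`** ((6), p. 39, last step):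
`|Q_{s,h,j}(α, e^y)| ≤ LD · (2^{n(b-1)} bⁿ H n(b-1) A^{n(b-1)} ε) · ((L+D)^s K₁(M)^L A^{degM})
  + |c|^L |f^{(s)}(h·y)|`. [cite: Ably1994, §II (6) p. 39] -/
theorem norm_aeval_Qj_le (p : Unk S.n L D b → ℤ) {H : ℝ} (hH0 : 0 ≤ H)
    (hH : ∀ w, |(p w : ℝ)| ≤ H) {M : ℕ} {h : Fin S.n → ℕ} (hh : ∀ j, h j < M) (s : ℕ)
    {z : Fin S.n → ℂ} {ε : ℝ} (hε0 : 0 ≤ ε) (hε1 : ε ≤ 1) (hz : ∀ j, ‖z j - S.θ j‖ ≤ ε)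
    (j : Fin (S.n + 1) →₀ ℕ) :
    ‖aeval (Fin.cons S.α S.θ : Fin (S.n + 1) → ℂ) (S.Qj p h s j)‖ ≤
      (L : ℝ) * D * ((2 ^ (S.n * (b - 1)) * ((b : ℝ) ^ S.n * H) * ((S.n * (b - 1) : ℕ) : ℝ) *
          S.A ^ (S.n * (b - 1)) * ε) * (((L : ℝ) + D) ^ s * S.K₁ M ^ L * S.A ^ S.degM D M)) +
        |(S.c : ℝ)| ^ L * ‖iteratedDeriv s
          (F fun β γ => aeval (Fin.cons S.α z : Fin (S.n + 1) → ℂ) (S.Pj p (β, γ) j)) (S.hy h)‖ := by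
  classical
  set x : Fin (S.n + 1) → ℂ := Fin.cons S.α z with hx
  set xθ : Fin (S.n + 1) → ℂ := Fin.cons S.α S.θ with hxθ
  set a : Fin L → Fin D → ℂ := fun β γ => aeval x (S.Pj p (β, γ) j) with ha
  have hz1 : ∀ j, ‖z j - S.θ j‖ ≤ 1 := fun j => (hz j).trans hε1
  -- `Q(θ) = ∑ (Pj(θ) - Pj(x̃)) M̃(θ) + ∑ a M̃(θ)` and `∑ a M̃(θ) = c^L f^{(s)}(h·y)`
  have h1 := S.sum_mul_aeval_Mt_exp a h s
  have hsplit : aeval xθ (S.Qj p h s j) =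
      ∑ βγ : Fin L × Fin D, (aeval xθ (S.Pj p βγ j) - aeval x (S.Pj p βγ j)) *
          aeval xθ (S.Mt L βγ.1 βγ.2 h s) +
        (S.c : ℂ) ^ L * iteratedDeriv s (F a) (S.hy h) := by
    rw [aeval_Qj, ← h1, ← Finset.sum_add_distrib]
    refine Finset.sum_congr rfl fun βγ _ => ?_
    simp only [ha, hxθ, hx]
    ring
  have hA0 : 0 ≤ S.A := zero_le_one.trans S.one_le_A
  have hK0 : 0 ≤ S.K₁ M := zero_le_one.trans (S.one_le_K₁ M)
  rw [hsplit]
  refine (norm_add_le _ _).trans (add_le_add ?_ ?_)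
  · refine (norm_sum_le _ _).trans ?_
    have hterm : ∀ βγ : Fin L × Fin D,
        ‖(aeval xθ (S.Pj p βγ j) - aeval x (S.Pj p βγ j)) * aeval xθ (S.Mt L βγ.1 βγ.2 h s)‖ ≤
        (2 ^ (S.n * (b - 1)) * ((b : ℝ) ^ S.n * H) * ((S.n * (b - 1) : ℕ) : ℝ) *
          S.A ^ (S.n * (b - 1)) * ε) * (((L : ℝ) + D) ^ s * S.K₁ M ^ L * S.A ^ S.degM D M) := by
      intro βγ
      rw [norm_mul]
      exact mul_le_mul (S.norm_aeval_Pj_sub_le p hH0 hH hε0 hε1 hz βγ j)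
        (S.norm_aeval_Mt_le βγ.1.isLt βγ.2.isLt hh s (fun j => S.norm_θ_sub_θ_le j))
        (norm_nonneg _) (by positivity)
    calc ∑ βγ : Fin L × Fin D,
          ‖(aeval xθ (S.Pj p βγ j) - aeval x (S.Pj p βγ j)) * aeval xθ (S.Mt L βγ.1 βγ.2 h s)‖
        ≤ ∑ _βγ : Fin L × Fin D, (2 ^ (S.n * (b - 1)) * ((b : ℝ) ^ S.n * H) *
            ((S.n * (b - 1) : ℕ) : ℝ) * S.A ^ (S.n * (b - 1)) * ε) *
            (((L : ℝ) + D) ^ s * S.K₁ M ^ L * S.A ^ S.degM D M) :=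
          Finset.sum_le_sum fun βγ _ => hterm βγ
      _ = _ := by
          simp [Finset.sum_const, Finset.card_univ, Fintype.card_prod, Fintype.card_fin, mul_assoc]
  · rw [norm_mul, norm_pow, Complex.norm_intCast]

end Setup


end LWMeasure

end Literature.NumberTheory.Transcendental

end
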